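import Literature.Analysis.FluidPDE.CheskidovShvydkoyRegularProofs
import Literature.Analysis.FluidPDE.TaoClassGlobal
import Literature.Analysis.FluidPDE.ClassicalSobolevUniqueness
import Literature.Analysis.FluidPDE.TaoLocalisationHolds

/-!
# Tao-class cover of closed sub-slabs (stub `stub_taoCover`, line `lp-vorticity-young-budget`)

Support file for the crux `RungReynoldsOne` of the thesis `TypeICertificateLadder`
(stmt-NavierStokesRegularity-2882), stub S5 of the lead's skeleton.

**Statement.** A classical solution `(u, p)` of the unforced Navier–Stokes system (viscosity
`ν > 0`) on `ℝ³ × [0, T)`, Leray–Hopf from its rapidly decaying datum `u 0`, is on every closed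
sub-slab `[0, T']`, `0 < T' < T`, a classical solution with SOME pressure `q` such that `u`,
`∂ₜu` (one-sided derivative within `[0, T']`) and `q` have all `L²` Sobolev norms bounded on
`[0, T']` — i.e. `u` is the velocity of a solution in Tao's smooth `H¹` class
(`IsTaoSolutionOn T' ν (u 0) u q`, Tao 2013, Thm. 5.4 / Cor. 11.1).

**Proof.** (a) On the closed slab `[0, T']` the solution is classical (`mono`) and has finite
energy (`IsLerayHopfOn.lintegral_enorm_sq_le`), so Tao 2013, Cor. 11.1 (the tree's theorem
`tao2011_hasBoundedSobolevNormsOn_holds`) bounds all `L²` Sobolev norms of `u` on `[0, T']`.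
(b) The general-viscosity version of the continuation argument of
`IsHkClassicalSolutionOn.exists_isTaoSolutionOn` (`TaoQuantitativeClass.lean`, `ν = 1`):
with `A = sup_t (‖u(t)‖²₂ + 3‖Du(t)‖²₂)` and the uniform lifespan `δ = cν³/(A² + 1)` of Tao's
local theorem (`tao2011_smooth_local_existence_holds`), Tao-class solutions start from every
slice `u(s)` and, by pressure-free uniqueness in the Sobolev class
(`IsClassicalNSSolutionOn.eq_of_hasBoundedSobolevNormsOn`, Majda–Bertozzi 2002, Cor. 3.1),
coincide with the translates `u(· + s)`; gluing (`IsTaoSolutionOn.glue`) `⌈2T'/δ⌉` of them gives a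
Tao-class solution on `[0, T']` whose velocity is `u`, and its pressure `q` serves
(`IsClassicalNSSolutionOn.congr_slices`, `derivWithin_congr`).

Sources: T. Tao, *Localisation and compactness properties of the Navier–Stokes global
regularity problem*, Anal. PDE 6 (2013), Thm. 5.4, Cor. 11.1; P. G. Lemarié-Rieusset,
*The Navier–Stokes Problem in the 21st Century* (2016), Thm. 7.2 (restart step);
A. J. Majda, A. L. Bertozzi, *Vorticity and Incompressible Flow* (2002), Cor. 3.1.
-/

noncomputable section

open Set Filter Topology MeasureTheory
open scoped RealInnerProductSpace ENNReal NNReal Laplacian ContDiff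
open Literature.Analysis.FluidPDE

namespace Summit.NavierStokesRegularity.NavierStokesRegularity.Theorems.RungReynoldsOne

-- the problem-side namespace `Summit.NavierStokesRegularity.NavierStokesRegularity.…` (summit =
-- problem for this single-problem summit) duplicates `NavierStokesRegularity` by design
set_option linter.dupNamespace false

/-- **A uniform bound of the `H¹` quantity of the slices** from the `n = 0, 1` Sobolev bounds:
if all `L²` Sobolev norms of `u` are bounded on `S`, there is `A ≥ 0` with
`‖u(t)‖²₂ + ∫|Du(t)|²_F ≤ A` for all `t ∈ S` (`|L|²_F ≤ 3‖L‖²` on `ℝ³`). General-viscosity copy of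
`IsHkClassicalSolutionOn.exists_h1_bound`. -/
theorem exists_h1_bound_of_hasBoundedSobolevNormsOn {S : Set ℝ}
    {u : ℝ → EuclideanSpace ℝ (Fin 3) → EuclideanSpace ℝ (Fin 3)}
    (hB : HasBoundedSobolevNormsOn S u) :
    ∃ A : ℝ, 0 ≤ A ∧ ∀ t ∈ S,
      (∫⁻ x, ‖u t x‖ₑ ^ 2) + (∫⁻ x, ENNReal.ofReal (frobeniusNormSq (fderiv ℝ (u t) x))) ≤
        ENNReal.ofReal A := by
  obtain ⟨C₀, hC₀⟩ := hB 0
  obtain ⟨C₁, hC₁⟩ := hB 1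
  refine ⟨(C₀ : ℝ) + 3 * C₁, by positivity, fun t ht => ?_⟩
  have h0 : ∫⁻ x, ‖u t x‖ₑ ^ 2 ≤ C₀ := by
    refine le_of_eq_of_le (lintegral_congr fun x => ?_) (hC₀ t ht)
    rw [← ofReal_norm, ← ofReal_norm (iteratedFDeriv ℝ 0 (u t) x), norm_iteratedFDeriv_zero]
  have h1 : ∫⁻ x, ENNReal.ofReal (frobeniusNormSq (fderiv ℝ (u t) x)) ≤ 3 * C₁ := by
    calc ∫⁻ x, ENNReal.ofReal (frobeniusNormSq (fderiv ℝ (u t) x))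
        ≤ ∫⁻ x, 3 * ‖iteratedFDeriv ℝ 1 (u t) x‖ₑ ^ 2 := lintegral_mono fun x => by
          rw [← ofReal_norm, norm_iteratedFDeriv_one, ofReal_norm]
          exact ofReal_frobeniusNormSq_le_three_mul_enorm_sq _
      _ = 3 * ∫⁻ x, ‖iteratedFDeriv ℝ 1 (u t) x‖ₑ ^ 2 := lintegral_const_mul' _ _ (by simp)
      _ ≤ 3 * C₁ := mul_le_mul_right (hC₁ t ht) 3
  calc (∫⁻ x, ‖u t x‖ₑ ^ 2) + (∫⁻ x, ENNReal.ofReal (frobeniusNormSq (fderiv ℝ (u t) x)))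
      ≤ (C₀ : ℝ≥0∞) + 3 * C₁ := add_le_add h0 h1
    _ = ENNReal.ofReal ((C₀ : ℝ) + 3 * C₁) := by
        rw [ENNReal.ofReal_add (by positivity) (by positivity), ENNReal.ofReal_coe_nnreal,
          ENNReal.ofReal_mul (by norm_num), ENNReal.ofReal_coe_nnreal, ENNReal.ofReal_ofNat]

/-- **Uniqueness: a Tao-class solution issued from a slice `u(s)` is the translate of `u`.** If
`(u, p)` is a classical solution (viscosity `ν ≥ 0`) on `[0, T]` with all `L²` Sobolev norms of
`u` bounded, `s ∈ [0, T]`, `0 < T'`, `s + T' ≤ T`, and `(v, q)` is a Tao-class solution on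
`[0, T']` with datum `u(s)`, then `v(t) = u(t + s)` for `t ∈ [0, T']` (pressure-free uniqueness
in the Sobolev class, `IsClassicalNSSolutionOn.eq_of_hasBoundedSobolevNormsOn`, Majda–Bertozzi
2002, Cor. 3.1, applied to `v` and the translate `u(· + s)`). -/
theorem eq_translate_of_isTaoSolutionOn_of_hasBoundedSobolevNormsOn {ν T : ℝ} (hν : 0 ≤ ν)
    {u : ℝ → EuclideanSpace ℝ (Fin 3) → EuclideanSpace ℝ (Fin 3)}
    {p : ℝ → EuclideanSpace ℝ (Fin 3) → ℝ}
    (h : IsClassicalNSSolutionOn (Icc 0 T) ν 0 u p) (hB : HasBoundedSobolevNormsOn (Icc 0 T) u)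
    {s : ℝ} (hs : s ∈ Icc 0 T) {T' : ℝ} (hT' : 0 < T') (hsT : s + T' ≤ T)
    {v : ℝ → EuclideanSpace ℝ (Fin 3) → EuclideanSpace ℝ (Fin 3)}
    {q : ℝ → EuclideanSpace ℝ (Fin 3) → ℝ} (hv : IsTaoSolutionOn T' ν (u s) v q) {t : ℝ}
    (ht : t ∈ Icc 0 T') : v t = u (t + s) := by
  have htr : IsClassicalNSSolutionOn (Icc 0 T') ν
      (fun r => (0 : ℝ → EuclideanSpace ℝ (Fin 3) → EuclideanSpace ℝ (Fin 3)) (r + s))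
      (fun r => u (r + s)) (fun r => p (r + s)) :=
    (h.comp_add_right s).mono (fun r hr => ⟨by linarith [hr.1, hs.1], by linarith [hr.2]⟩)
      (uniqueDiffOn_Icc hT')
  have hBtr : HasBoundedSobolevNormsOn (Icc 0 T') (fun r => u (r + s)) := fun n =>
    (hB n).imp fun _ hC r hr => hC (r + s) ⟨by linarith [hr.1, hs.1], by linarith [hr.2]⟩
  have h0 : v 0 = (fun r => u (r + s)) 0 := by
    simp only [zero_add]
    exact hv.initial
  exact IsClassicalNSSolutionOn.eq_of_hasBoundedSobolevNormsOn hv.classical htr hν hT'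
    hv.sobolev hBtr h0 ht

/-- **A classical solution with bounded Sobolev norms on a closed slab is in Tao's smooth `H¹`
class** (general viscosity `ν > 0`; Tao 2013, Thm. 5.4 with Lemarié-Rieusset 2016, Thm. 7.2,
restart step). If `(u, p)` is a classical solution of the unforced Navier–Stokes system on
`[0, T] × ℝ³`, `0 < T`, with `sup_t ‖∇ⁿu(t)‖_{L²} < ∞` for all `n`, then there is a pressure `q`
with `(u, q)` in Tao's class `IsTaoSolutionOn T ν (u 0) u q` (`u, ∂ₜu, q ∈ L^∞_t H^k_x` for all
`k`, `u ∈ C([0,T]; L²)`). Continuation argument with the proved local existence theorem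
`tao2011_smooth_local_existence_holds`, the uniform `H¹` bound of the slices
(`exists_h1_bound_of_hasBoundedSobolevNormsOn`), uniqueness in the Sobolev class
(`eq_translate_of_isTaoSolutionOn_of_hasBoundedSobolevNormsOn`) and gluing
(`IsTaoSolutionOn.glue`); general-viscosity copy of
`IsHkClassicalSolutionOn.exists_isTaoSolutionOn`. -/
theorem exists_isTaoSolutionOn_of_hasBoundedSobolevNormsOn {ν T : ℝ} (hν : 0 < ν) (hT : 0 < T)
    {u : ℝ → EuclideanSpace ℝ (Fin 3) → EuclideanSpace ℝ (Fin 3)}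
    {p : ℝ → EuclideanSpace ℝ (Fin 3) → ℝ}
    (h : IsClassicalNSSolutionOn (Icc 0 T) ν 0 u p) (hB : HasBoundedSobolevNormsOn (Icc 0 T) u) :
    ∃ q : ℝ → EuclideanSpace ℝ (Fin 3) → ℝ, IsTaoSolutionOn T ν (u 0) u q := by
  obtain ⟨c, hc, hloc⟩ := IsTaoSolutionOn.of_tao tao2011_smooth_local_existence_holds
  obtain ⟨A, hA0, hslice⟩ := exists_h1_bound_of_hasBoundedSobolevNormsOn hB
  -- the uniform lifespan `δ`
  set δ : ℝ := c * ν ^ 3 / (A ^ 2 + 1) with hδ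
  have hδpos : 0 < δ := by positivity
  have hδc : A ^ 2 * δ ≤ c * ν ^ 3 := by
    calc A ^ 2 * δ = c * ν ^ 3 * (A ^ 2 / (A ^ 2 + 1)) := by rw [hδ]; ring
      _ ≤ c * ν ^ 3 * 1 :=
          mul_le_mul_of_nonneg_left (by rw [div_le_one (by positivity)]; linarith) (by positivity)
      _ = c * ν ^ 3 := mul_one _
  -- all Sobolev norms of all slices are finite
  have hfin : ∀ s ∈ Icc 0 T, ∀ n : ℕ, ∫⁻ x, ‖iteratedFDeriv ℝ n (u s) x‖ₑ ^ 2 < ⊤ :=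
    fun s hs n => by
    obtain ⟨C, hC⟩ := hB n
    exact (hC s hs).trans_lt ENNReal.coe_lt_top
  -- Tao-class solutions start from every slice `u s` and live for time `δ`
  have hstart : ∀ s ∈ Icc 0 T, ∀ ⦃T' : ℝ⦄, 0 < T' → T' ≤ δ →
      ∃ (v : ℝ → EuclideanSpace ℝ (Fin 3) → EuclideanSpace ℝ (Fin 3))
        (q : ℝ → EuclideanSpace ℝ (Fin 3) → ℝ), IsTaoSolutionOn T' ν (u s) v q := by
    intro s hs T' hT' hT'δ
    exact hloc hν hT' (h.contDiff_velocity hs) (h.divFree s hs) (hfin s hs) hA0 (hslice s hs)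
      ((mul_le_mul_of_nonneg_left hT'δ (sq_nonneg _)).trans hδc)
  -- continuation by induction: a Tao-class solution from `u 0` on `[0, min (δ/2 (n+1)) T]`
  set S : ℕ → ℝ := fun n => min (δ / 2 * ((n : ℝ) + 1)) T with hS
  have hSpos : ∀ n, 0 < S n := fun n => lt_min (by positivity) hT
  have hSle : ∀ n, S n ≤ T := fun n => min_le_right _ _
  have h0I : (0 : ℝ) ∈ Icc 0 T := ⟨le_rfl, hT.le⟩
  have hclaim : ∀ n : ℕ, ∃ (v : ℝ → EuclideanSpace ℝ (Fin 3) → EuclideanSpace ℝ (Fin 3))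
      (q : ℝ → EuclideanSpace ℝ (Fin 3) → ℝ), IsTaoSolutionOn (S n) ν (u 0) v q := by
    intro n
    induction n with
    | zero =>
      have hS0 : S 0 ≤ δ := by
        refine (min_le_left _ _).trans ?_
        rw [Nat.cast_zero, zero_add, mul_one]
        linarith
      exact hstart 0 h0I (hSpos 0) hS0
    | succ n ih =>
      obtain ⟨v, q, hv⟩ := ih
      by_cases hcase : T ≤ δ / 2 * ((n : ℝ) + 1)
      · -- the interval has already reached `T`
        have hSn : S n = T := min_eq_right hcase
        have hSn1 : S (n + 1) = T := by
          refine min_eq_right (hcase.trans ?_)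
          push_cast
          nlinarith [hδpos.le]
        refine ⟨v, q, ?_⟩
        rw [hSn1, ← hSn]
        exact hv
      · push Not at hcase
        have hSn : S n = δ / 2 * ((n : ℝ) + 1) := min_eq_left hcase.le
        set a₀ : ℝ := δ / 2 * (n : ℝ) with ha₀
        have ha₀0 : 0 ≤ a₀ := by positivity
        have ha₀S : a₀ < S n := by rw [hSn, ha₀]; nlinarith [hδpos]
        have ha₀T : a₀ < T := ha₀S.trans_le (hSle n)
        set T₂ : ℝ := min δ (T - a₀) with hT₂
        have hT₂pos : 0 < T₂ := lt_min hδpos (sub_pos.2 ha₀T)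
        have hT₂δ : T₂ ≤ δ := min_le_left _ _
        have ha₀I : a₀ ∈ Icc 0 T := ⟨ha₀0, ha₀T.le⟩
        -- restart from `u a₀ = v a₀`
        obtain ⟨v₂, q₂, hv₂⟩ := hstart a₀ ha₀I hT₂pos hT₂δ
        have hva₀ : v a₀ = u a₀ := by
          have := eq_translate_of_isTaoSolutionOn_of_hasBoundedSobolevNormsOn hν.le h hB h0I
            (hSpos n) (by simpa using hSle n) hv (t := a₀) ⟨ha₀0, ha₀S.le⟩
          simpa using this
        rw [← hva₀] at hv₂
        have hend : a₀ + T₂ = S (n + 1) := by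
          rw [hT₂, ← min_add_add_left, add_sub_cancel, hS]
          dsimp only
          congr 1
          rw [ha₀]
          push_cast
          ring
        have hle : S n ≤ a₀ + T₂ := by
          rw [hT₂, ← min_add_add_left, add_sub_cancel]
          refine le_min ?_ (hSle n)
          rw [hSn, ha₀]
          nlinarith [hδpos]
        have hglue := hv.glue hv₂ hν hT₂pos ha₀0 ha₀S hle
        rw [hend] at hglue
        exact ⟨_, _, hglue⟩
  -- enough steps reach `T`
  obtain ⟨n, hn⟩ := exists_nat_gt (T / (δ / 2))
  have hreach : T ≤ δ / 2 * ((n : ℝ) + 1) := by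
    rw [div_lt_iff₀ (by positivity)] at hn
    nlinarith [hδpos]
  obtain ⟨v, q, hv⟩ := hclaim n
  have hSn : S n = T := min_eq_right hreach
  rw [hSn] at hv
  -- the Tao-class velocity from `u 0` on `[0, T]` is `u`
  have hvu : ∀ t ∈ Icc 0 T, v t = u t := fun t ht => by
    simpa using eq_translate_of_isTaoSolutionOn_of_hasBoundedSobolevNormsOn hν.le h hB h0I hT
      (by simp) hv ht
  refine ⟨q, ⟨hv.classical.congr_slices (fun t ht => (hvu t ht).symm) fun _ _ => rfl, rfl,
    hB, ?_, hv.sobolev_p, hv.continuousL2.congr_eqOn hvu⟩⟩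
  intro n
  obtain ⟨C, hC⟩ := hv.sobolev_dt n
  refine ⟨C, fun t ht => ?_⟩
  have heq : timeDerivWithin (Icc 0 T) u t = timeDerivWithin (Icc 0 T) v t := by
    funext x
    simp only [timeDerivWithin_apply]
    exact derivWithin_congr (fun s hs => by rw [hvu s hs]) (by rw [hvu t ht])
  rw [heq]
  exact hC t ht

/-- **S5 — Tao-class cover of closed sub-slabs.** A classical solution of the unforced system on
`ℝ³ × [0,T)`, Leray–Hopf from its rapidly decaying datum, is on every closed sub-slab `[0,T']`,
`T' < T`, a classical solution with SOME pressure `q` (the Leray pressure, `= p` up to a function of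
time) such that `u`, `∂ₜu`, `q` have all `L²` Sobolev norms bounded (Tao 2013 Thm 5.4 / Cor 11.1).
Proof: `tao2011_hasBoundedSobolevNormsOn_holds` gives the `u`-bounds on `[0,T']` (finite energy from
`IsLerayHopfOn.lintegral_enorm_sq_le`), and `exists_isTaoSolutionOn_of_hasBoundedSobolevNormsOn`
supplies the Tao-class pressure. -/
theorem stub_taoCover :
    ∀ ⦃ν T : ℝ⦄, 0 < ν → 0 < T →
    ∀ ⦃u : ℝ → EuclideanSpace ℝ (Fin 3) → EuclideanSpace ℝ (Fin 3)⦄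
      ⦃p : ℝ → EuclideanSpace ℝ (Fin 3) → ℝ⦄,
      IsClassicalNSSolutionOn (Ico 0 T) ν 0 u p → IsLerayHopfOn T ν 0 (u 0) u →
      HasRapidSpatialDecay (u 0) →
    ∀ ⦃T' : ℝ⦄, T' ∈ Ioo 0 T →
      ∃ q : ℝ → EuclideanSpace ℝ (Fin 3) → ℝ,
        IsClassicalNSSolutionOn (Icc 0 T') ν 0 u q ∧
        HasBoundedSobolevNormsOn (Icc 0 T') u ∧
        HasBoundedSobolevNormsOn (Icc 0 T') (timeDerivWithin (Icc 0 T') u) ∧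
        (∀ n : ℕ, ∃ C : ℝ≥0, ∀ t ∈ Icc 0 T', ∫⁻ x, ‖iteratedFDeriv ℝ n (q t) x‖ₑ ^ 2 ≤ C) := by
  intro ν T hν _hT u p hsol hLH hdec T' hT'
  have hsolc : IsClassicalNSSolutionOn (Icc 0 T') ν 0 u p :=
    hsol.mono (Icc_subset_Ico_right hT'.2) (uniqueDiffOn_Icc hT'.1)
  have hE : ∃ C : ℝ≥0, ∀ t ∈ Icc 0 T', ∫⁻ x, ‖u t x‖ₑ ^ 2 ≤ C :=
    ⟨(2 * VectorCalculus.kineticEnergy (u 0)).toNNReal, fun t ht =>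
      hLH.lintegral_enorm_sq_le hν.le ⟨ht.1, ht.2.trans hT'.2.le⟩⟩
  have hB : HasBoundedSobolevNormsOn (Icc 0 T') u :=
    tao2011_hasBoundedSobolevNormsOn_holds hν hT'.1 hsolc hE hdec
  obtain ⟨q, hq⟩ := exists_isTaoSolutionOn_of_hasBoundedSobolevNormsOn hν hT'.1 hsolc hB
  exact ⟨q, hq.classical, hq.sobolev, hq.sobolev_dt, hq.sobolev_p⟩

end Summit.NavierStokesRegularity.NavierStokesRegularity.Theorems.RungReynoldsOne

end
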